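import Literature.MathematicalPhysics.QuantumFieldTheory.Balaban1983to89.B16Sect1Backgrounds

/-!
# NODE 00 — [3] (78)–(88) AT FLAT BACKGROUND for an ABSTRACT point-covariant averaging: the gauge function of the axial→Landau re-gauging
# read INTRINSICALLY from the re-gauged configuration ((82), (84), (86), (87)), and the SHEARED average whose value is the PURE DATA ((88) ∕ [B11] (154)₁)
# — every `Setup.Averaging`, every `Setup.ContourData`, every block average of gauge functions with the base point factored; every `GaugeGroup`

Cell `pub-ymgap` (HUMAN RULINGS D-0062 ∕ D-0088), seat `pub-ymgap-dag-n07-e` g19 (R141 (C) row s3 lineage; DAG node N07 = [B11]), 2026-08-28.  `--kind definition --supports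
stmt-QuantumFields-20541` (K0⁷; count-neutral).  ITEM R4 file 1 of the lineage's `STUB1-SECTF-MAP.md` § BRIDGE-92-B (the road-independent DATA half of
GAP-STATED(avg-universality)).

THE PRINT.  [3] = T. Bałaban, *Averaging operations for lattice gauge theories*, Commun. Math. Phys. **98** (1985) 17–51 `[Balaban1985Averaging]`, Sect. 2 pp. 28–31
(p. 31 READ AS IMAGE `run/shared/lean/pub/pub-balaban/b2b-balaban-ref1/pages/1985-cmp98-averaging/1985-cmp98-averaging-p015-x2.png`):
* (64) p. 29 «(R_{0,y}U′)(Γ_{y,x}) = 1, x ∈ B(y), x ≠ y, y ∈ Ω^{(1)}» (the block axial gauge of `U′`); (70)–(71) «we apply a gauge transformation u⁻¹ to U′. We get some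
  configuration U₁ and U′ = U₁^u»; (72)–(73) «Solving these equations, we get (R_{0,x₁}u)(x) = u(x₁)(R_{0,x₁}U₁)(Γ_{x₁,x}) for x ∈ B(x₁)» — here (82): `u(x) = u(y)·U₁(Γ_{y,x})` at
  flat background;
* (78) p. 30 «(R̄₀v)(y) = v(y) exp[i Σ_{x∈B(y)} L^{−d} (1∕i) log v⁻¹(y)v(x)R(V₀(Γ_{y,x}))]» — the one-step average of a gauge function WITH THE BASE POINT FACTORED; (79)–(80) its
  iterate `R̄₀ʲ`; (81) «The additional conditions are (R̄₀ᵏu_k)(y) = 1, y ∈ Ω^{(k)}»;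
* (84)–(85) p. 30–31 «(R̄₀ʲu)(x_j) = u(x_j)·R̄_{0,x_j}U₁^{(j)}, x_j ∈ Ω^{(j)}» with `R̄_{0,·}U₁^{(·)}` defined inductively; (86)–(87) p. 31 «(R̄₀uᵏ)(y) = u(y)·R̄_{0,y}U₁^{(k)} = 1 for
  y ∈ Ω^{(k)}, hence u(y) = (R̄_{0,y}U₁^{(k)})⁻¹»; (88) «Ū′ᵏ_b(Ū₀ᵏ)_b⁻¹ = u(b₋)(U₁U₀‾ᵏ)_b(Ū₀ᵏ)_b⁻¹R̄ᵏ_{0,b}u⁻¹(b₊) = (R̄_{0,b₋}U₁^{(k)})⁻¹ Ũ₁ᵏ R̄ᵏ_{0,b} R̄_{0,b₊}U₁^{(k)} … We may consider this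
  expression as a new averaging operation of kth order acting on a configuration U₁».
* [B11] = CMP **102** (1985) `[Balaban1985Variational]` p. 302 (154)₁ «Ū₁ʲ(x, x′) = V″(x, x′) for ⟨x, x′⟩ ∈ Λ′_j, x, x′ ∈ Λ′_j» and p. 301 «there exists a unique gauge
  transformation u satisfying the restrictions ūʲ = 1 on Λ′_j».

WHY THIS FILE.  [B11] Sect. F rewrites the constraint «`U′ ∈ 𝔅_k(ℭ_k, V″)`» of the axial-gauged minimiser `U′` for its Landau re-gauging `U₁ = U′^{u⁻¹}` ((152)–(156)); for an
averaging that is covariant with POINT values at block centres — `Setup.Averaging.covariant`: `avg (U^u) = (avg U)^{u∘emb}`, the (0.4) averaging of record `Node00.avOfRecord` —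
`avg_j(U₁) = (u∘emb)⁻¹ · V″ · (u∘emb)` is SHEARED by the point values of `u` (lineage located note BRIDGE-92-B, road R0).  Print's (82)–(87) express those point values
INTRINSICALLY through `U₁`, using ONLY the axial gauge of `U′` and the (81)-normalisation of `u` — not the averaging that defines the constraint — so the sheared average is a
functional of `U₁` ALONE whose value is the PURE DATA `V″` ((88) ∕ (154)₁).  THIS FILE types exactly that, at flat background (`U₀ = 1`, as in [B11] Sect. F «all the operators in
this section are taken … with the configuration equal to 1»), for ABSTRACT data: an averaging `av` (only `covariant` is used), a contour datum `cd` (only `covariant` is used) and a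
block average of site fields `𝓔` (only locality on the block is used); print's (92) — the identification of the new operation with a COMPOSITION of one-step operations,
which organises the multi-level LINEAR analysis — is NOT needed for the data side and is not claimed.

WHAT IS TYPED.
* §1 one step `T^{(j)} → T^{(j+1)}`: `gaugeAvgF 𝓔 v` ((78) flat: `v(emb y)·𝓔_y{v(emb y)⁻¹v(x)}`), `shearR cd 𝓔 U₁` ((82)∕(85) one step: `𝓔_y{U₁(Γ_{y,x})}`), `shearedAvg av cd 𝓔 U₁`
  ((88) one step: `c ↦ (shearR U₁ c₋)⁻¹·avg U₁ c·shearR U₁ c₊`); ★ `gauge_eq_of_axialGauge` ((82): `u x = u(emb y)·U₁(Γ_{y,x})` on `B(y) ∖ {y}` from `AxialGauge cd (U₁^u)`),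
  ★ `gaugeAvgF_eq_mul_shearR` ((86)), ★★ `gauge_emb_eq_shearR_inv` ((87): `(R̄u)(y) = 1 ⇒ u(emb y) = (shearR U₁ y)⁻¹`), ★ `avg_gaugeAct_apply` (point covariance read at a bond),
  ★★★ `shearedAvg_eq_avg_gauge` ((88)∕(154)₁: normalised at both ends of `c` ⇒ `shearedAvg U₁ c = avg (U₁^u) c` — the DATA), `shearedAvg_eq_data`.
* §2 the hierarchy over `T^{(0)} → … → T^{(k)}` for families `av i`, `cd i`, `𝓔 i`: `gaugeAvgIter` ((79)–(80): `R̄ʲu`), `shearRIter` ((85): the inductive intrinsic factor),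
  `shearedAvgIter` (the level-`j` sheared average of `M^j(U₁)`); ★ `toMS_eq_of_axialGauge` ((76)∕(82) at level `i` for `toMS u i`), ★★ `gaugeAvgIter_eq_mul_shearRIter` ((84) by
  induction), ★★ `toMS_eq_shearRIter_inv` ((87) at every normalised site of every level), ★★★ `shearedAvgIter_eq_iter_gauge` ∕ `shearedAvgIter_eq_data` ((154)₁ at level `j`:
  normalised at both ends ⇒ the sheared average of `M^j(U₁)` IS `M^j(U′)(c) = V″(c)`).
DESIGN NOTE (dag-n07-w7 g0 ROAD-CHECK, cell bus 2026-08-28 I.29243, exact d = 2 witness).  The BLOCK average `𝓔` of (78)∕(85) is essential and is kept exactly as printed: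
it is what makes the linearisation of `shearedAvgIter` intertwine fine gradients with the COARSE BLOCK MEAN (the operator that defines print's projection `R`), so that
the flat quadratic form of the heart stays positive; the degenerate «purely axial» reading (`u∘emb` from the hierarchical axial holonomies alone, no block average) would make
the sheared average invariant under EVERY fine gauge, its linearisation would kill all gradients, and `Δ_a` would be singular (kernel dimension `M² − 1` at `d = 2`).  The
linearisation itself (R4 file 2: first theorem `lin₁(shearedAvgIter)(∂μ) = ∂_c(blockMeanʲ μ)`) is NOT in this file.

HONEST FRAMING.  Algebra over the tree's `Setup` interface; flat background only; two displayed mild hypotheses (`𝓔` local on blocks — print's (78) is a block sum; `cd` trivial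
at the centre — print's `Γ_{y,y}` is the empty contour); nothing of [3] Sect. 3 ∕ [B11] Sect. F ANALYSIS ((92), the linearisation (157), Props 3–8) is asserted; BRIDGE-92's
residue (the linearisation of `shearedAvg` = `LʲηQ_{B5} + ∂∘𝒦∘curl`, and the heart with it) is NOT here; tokens ∕ stub 1 ∕ K0⁷ NOT closed; N07 NOT discharged; count-neutral;
one finite `T⁴` programme at fixed `ε`, Bałaban AS PRINTED — R4 closes rung `BalabanLadder.UV` only; NOT continuum ∕ ℝ⁴ ∕ OS ∕ mass gap ∕ Clay.  No `sorry`, no `instance`, no `notation`.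
-/

namespace Literature.MathematicalPhysics.QuantumFieldTheory.Balaban1983to89.Node00

open B16Sect1Backgrounds (toMS iter_gaugeAct)
open B15DeterminingSets (embIter)
open GaugeField (gaugeAct)

variable {P : Params} {G : Type*} [GaugeGroup G]

/-! ## §1  One step `T^{(j)} → T^{(j+1)}` -/

section OneStep

variable {j : ℕ}

/-- **(78) at flat background, abstract inner operation**: the one-step average of a gauge function `v` of `T^{(j)}` WITH THE BASE POINT FACTORED,
`(R̄v)(y) = v(y)·𝓔_y{v(y)⁻¹v(x)}_{x∈B(y)}` — print's `𝓔_y` is `exp[i Σ_{x∈B(y)} L^{−d}(1∕i) log ·]`; here ANY block operation `𝓔 : T^{(j+1)} → (T^{(j)} → G) → G`.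
[cite: Balaban1985Averaging, (78) p.30] -/
def gaugeAvgF (𝓔 : Site P (j+1) → (Site P j → G) → G) (v : GaugeTransf P j G) : GaugeTransf P (j+1) G :=
  fun y => v (emb y) * 𝓔 y (fun x => (v (emb y))⁻¹ * v x)

/-- **(82)∕(85), one step, flat**: the INTRINSIC factor `R̄_{0,y}U₁ := 𝓔_y{U₁(Γ_{y,x})}_{x∈B(y)}` — the block average of the contour variables of `U₁` from the centre.
[cite: Balaban1985Averaging, (82) p.30, (85) p.31] -/
def shearR (cd : ContourData P j G) (𝓔 : Site P (j+1) → (Site P j → G) → G) (U₁ : GaugeField P j G) : GaugeTransf P (j+1) G :=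
  fun y => 𝓔 y (fun x => cd.holTo U₁ y x)

/-- **(88), one step, flat — «a new averaging operation … acting on a configuration U₁»**: the SHEARED average
`c ↦ (R̄_{0,c₋}U₁)⁻¹ · Ū₁(c) · R̄_{0,c₊}U₁`. [cite: Balaban1985Averaging, (88) p.31] -/
def shearedAvg (av : Averaging P j G) (cd : ContourData P j G) (𝓔 : Site P (j+1) → (Site P j → G) → G) (U₁ : GaugeField P j G) :
    GaugeField P (j+1) G :=
  fun c => (shearR cd 𝓔 U₁ c.src)⁻¹ * av.avg U₁ c * shearR cd 𝓔 U₁ c.tgt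

variable (cd : ContourData P j G) (𝓔 : Site P (j+1) → (Site P j → G) → G)

/-- ★ **(82) at flat background** («(R_{0,x₁}u)(x) = u(x₁)(R_{0,x₁}U₁)(Γ_{x₁,x})», (73) with `U₀ = 1`): if `U′ = U₁^u` is in the block axial gauge of the contour datum `cd`, then
on every block `u(x) = u(emb y)·U₁(Γ_{y,x})`, `x ∈ B(y)`, `x ≠ y` — from `cd.covariant` alone. [cite: Balaban1985Averaging, (73) p.29, (82) p.30] -/
theorem gauge_eq_of_axialGauge {u : GaugeTransf P j G} {U₁ : GaugeField P j G} (hax : AxialGauge cd (gaugeAct u U₁))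
    {y : Site P (j+1)} {x : Site P j} (hx : blockOf x = y) (hxy : x ≠ emb y) :
    u x = u (emb y) * cd.holTo U₁ y x := by
  have h := hax y x hx hxy
  rw [cd.covariant] at h
  exact (mul_inv_eq_one.mp h).symm

/-- ★ **(86), one step, flat** («(R̄₀uᵏ)(y) = u(y)R̄_{0,y}U₁^{(k)}»): under the axial gauge of `U₁^u`, `(R̄u)(y) = u(emb y)·R̄_{0,y}U₁` — for a block operation `𝓔` that is LOCAL on
blocks (hypothesis `h𝓔`) and a contour datum trivial at the centre (`hctr`, print's empty contour `Γ_{y,y}`). [cite: Balaban1985Averaging, (86) p.31] -/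
theorem gaugeAvgF_eq_mul_shearR (h𝓔 : ∀ (y : Site P (j+1)) (f f' : Site P j → G), (∀ x, blockOf x = y → f x = f' x) → 𝓔 y f = 𝓔 y f')
    (hctr : ∀ (U : GaugeField P j G) (y : Site P (j+1)), cd.holTo U y (emb y) = 1)
    {u : GaugeTransf P j G} {U₁ : GaugeField P j G} (hax : AxialGauge cd (gaugeAct u U₁)) (y : Site P (j+1)) :
    gaugeAvgF 𝓔 u y = u (emb y) * shearR cd 𝓔 U₁ y := by
  unfold gaugeAvgF shearR
  congr 1
  refine h𝓔 y _ _ fun x hx => ?_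
  by_cases hxy : x = emb y
  · subst hxy
    rw [hctr, inv_mul_eq_one]
  · rw [gauge_eq_of_axialGauge cd hax hx hxy, ← mul_assoc, inv_mul_cancel, one_mul]

/-- ★★ **(87), one step, flat** («hence u(y) = (R̄_{0,y}U₁^{(k)})⁻¹»): under the axial gauge of `U₁^u` and the normalisation (81) `(R̄u)(y) = 1` at `y`, the gauge function at the
centre of `B(y)` is the INTRINSIC quantity `(R̄_{0,y}U₁)⁻¹`. [cite: Balaban1985Averaging, (87) p.31] -/
theorem gauge_emb_eq_shearR_inv (h𝓔 : ∀ (y : Site P (j+1)) (f f' : Site P j → G), (∀ x, blockOf x = y → f x = f' x) → 𝓔 y f = 𝓔 y f')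
    (hctr : ∀ (U : GaugeField P j G) (y : Site P (j+1)), cd.holTo U y (emb y) = 1)
    {u : GaugeTransf P j G} {U₁ : GaugeField P j G} (hax : AxialGauge cd (gaugeAct u U₁)) {y : Site P (j+1)} (h81 : gaugeAvgF 𝓔 u y = 1) :
    u (emb y) = (shearR cd 𝓔 U₁ y)⁻¹ := by
  rw [gaugeAvgF_eq_mul_shearR cd 𝓔 h𝓔 hctr hax y] at h81
  exact eq_inv_of_mul_eq_one_left h81

/-- ★ Point covariance of the averaging read at one bond ([3] (11) p. 19 ∕ [Balaban1987RG1] p. 253; `Setup.Averaging.covariant`, standing range `j + 1 ≤ m + K`):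
`Ū′(c) = u(emb c₋)·Ū₁(c)·u(emb c₊)⁻¹` for `U′ = U₁^u`. [cite: Balaban1985Averaging, (11) p.19] -/
theorem avg_gaugeAct_apply (av : Averaging P j G) (hj : j + 1 ≤ P.m + P.K) (u : GaugeTransf P j G) (U₁ : GaugeField P j G) (c : PBond P (j+1)) :
    av.avg (gaugeAct u U₁) c = u (emb c.src) * av.avg U₁ c * (u (emb c.tgt))⁻¹ := by
  rw [av.covariant hj u U₁]
  rfl

/-- ★★★ **(88) ∕ [B11] (154)₁, one step, flat — THE SHEARED AVERAGE OF `U₁` IS THE AVERAGE OF THE AXIAL-GAUGED `U′ = U₁^u`**: if `U₁^u` is block-axial for `cd` and `u` is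
(81)-normalised at both ends of the coarse bond `c`, then `(R̄_{0,c₋}U₁)⁻¹·Ū₁(c)·R̄_{0,c₊}U₁ = Ū′(c)` — an identity between a functional of `U₁` ALONE and the constraint datum.
[cite: Balaban1985Averaging, (88) p.31; Balaban1985Variational, (154) p.302] -/
theorem shearedAvg_eq_avg_gauge (av : Averaging P j G) (hj : j + 1 ≤ P.m + P.K)
    (h𝓔 : ∀ (y : Site P (j+1)) (f f' : Site P j → G), (∀ x, blockOf x = y → f x = f' x) → 𝓔 y f = 𝓔 y f')
    (hctr : ∀ (U : GaugeField P j G) (y : Site P (j+1)), cd.holTo U y (emb y) = 1)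
    {u : GaugeTransf P j G} {U₁ : GaugeField P j G} (hax : AxialGauge cd (gaugeAct u U₁))
    {c : PBond P (j+1)} (hsrc : gaugeAvgF 𝓔 u c.src = 1) (htgt : gaugeAvgF 𝓔 u c.tgt = 1) :
    shearedAvg av cd 𝓔 U₁ c = av.avg (gaugeAct u U₁) c := by
  rw [avg_gaugeAct_apply av hj u U₁ c, gauge_emb_eq_shearR_inv cd 𝓔 h𝓔 hctr hax hsrc, gauge_emb_eq_shearR_inv cd 𝓔 h𝓔 hctr hax htgt, inv_inv]
  rfl

/-- **(154)₁ as print states it** («Ū₁ʲ(x, x′) = V″(x, x′) for ⟨x, x′⟩ ∈ Λ′_j»): with the constraint `Ū′(c) = V″(c)` at the bond, the sheared average of `U₁` equals the DATA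
`V″(c)`. [cite: Balaban1985Variational, (154) p.302] -/
theorem shearedAvg_eq_data (av : Averaging P j G) (hj : j + 1 ≤ P.m + P.K)
    (h𝓔 : ∀ (y : Site P (j+1)) (f f' : Site P j → G), (∀ x, blockOf x = y → f x = f' x) → 𝓔 y f = 𝓔 y f')
    (hctr : ∀ (U : GaugeField P j G) (y : Site P (j+1)), cd.holTo U y (emb y) = 1)
    {u : GaugeTransf P j G} {U₁ : GaugeField P j G} (hax : AxialGauge cd (gaugeAct u U₁))
    {V : GaugeField P (j+1) G} {c : PBond P (j+1)} (hV : av.avg (gaugeAct u U₁) c = V c)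
    (hsrc : gaugeAvgF 𝓔 u c.src = 1) (htgt : gaugeAvgF 𝓔 u c.tgt = 1) :
    shearedAvg av cd 𝓔 U₁ c = V c := by
  rw [shearedAvg_eq_avg_gauge cd 𝓔 av hj h𝓔 hctr hax hsrc htgt, hV]

end OneStep

/-! ## §2  The hierarchy `T^{(0)} → T^{(1)} → … → T^{(k)}` ((79)–(80), (84)–(87), and (154)₁ at every level) -/

section Hierarchy

variable (av : ∀ i, Averaging P i G) (cd : ∀ i, ContourData P i G) (𝓔 : ∀ i, Site P (i+1) → (Site P i → G) → G)

/-- **(79)–(80) at flat background**: the `i`-fold average `R̄₀ⁱu` of a gauge function of `T^{(0)} = T_η`, iterating the base-point-factored one-step average (78).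
[cite: Balaban1985Averaging, (79)–(80) p.30] -/
def gaugeAvgIter (u : GaugeTransf P 0 G) : (i : ℕ) → GaugeTransf P i G
  | 0 => u
  | i + 1 => gaugeAvgF (𝓔 i) (gaugeAvgIter u i)

/-- **(85) at flat background — the inductive INTRINSIC factor `R̄_{0,x_i}U₁^{(i)}`**: `S₀ = 1`, `S_{i+1}(y) = S_i(emb y)·𝓔_y{S_i(emb y)⁻¹ · M^i(U₁)(Γ_{y,x}) · S_i(x)}`
(print: «R̄_{0,x_{j+1}}U₁^{(j+1)} = {(R̄ʲ… Ũ₁ʲ)(Γ_{x_{j+1},x_j})(R̄ʲ… R̄_{0,x_j}U₁^{(j)})(x_j)}_{x_j∈B(x_{j+1})}», flat, base point factored). [cite: Balaban1985Averaging, (85) p.31] -/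
def shearRIter (U₁ : GaugeField P 0 G) : (i : ℕ) → GaugeTransf P i G
  | 0 => fun _ => 1
  | i + 1 => fun y => shearRIter U₁ i (emb y) *
      𝓔 i y (fun x => (shearRIter U₁ i (emb y))⁻¹ * (cd i).holTo (Averaging.iter av i U₁) y x * shearRIter U₁ i x)

/-- **(88) at level `j`, flat**: the SHEARED `j`-fold average of `U₁`, `c ↦ (S_j(c₋))⁻¹ · M^j(U₁)(c) · S_j(c₊)` on the bonds of `T^{(j)}`. [cite: Balaban1985Averaging, (88) p.31] -/
def shearedAvgIter (U₁ : GaugeField P 0 G) (j : ℕ) : GaugeField P j G :=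
  fun c => (shearRIter av cd 𝓔 U₁ j c.src)⁻¹ * Averaging.iter av j U₁ c * shearRIter av cd 𝓔 U₁ j c.tgt

/-- `R̄⁰u = u`, `R̄^{i+1}u = R̄(R̄ⁱu)` (definitional). [cite: Balaban1985Averaging, (79)–(80) p.30] -/
@[simp] theorem gaugeAvgIter_zero (u : GaugeTransf P 0 G) : gaugeAvgIter 𝓔 u 0 = u := rfl

/-- `R̄^{i+1}u = R̄(R̄ⁱu)` (definitional). [cite: Balaban1985Averaging, (80) p.30] -/
theorem gaugeAvgIter_succ (u : GaugeTransf P 0 G) (i : ℕ) : gaugeAvgIter 𝓔 u (i + 1) = gaugeAvgF (𝓔 i) (gaugeAvgIter 𝓔 u i) := rfl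

/-- ★ **(76) ∕ (82) at level `i`, flat**: if the `i`-fold average of `U′ = U₁^u` is block-axial for `cd i` (`i ≤ m + K`), the level-`i` gauge function `u↾T^{(i)}` satisfies
`u(x) = u(emb y)·M^i(U₁)(Γ_{y,x})` on `B(y) ∖ {y}` (r13's `iter_gaugeAct`: `M^i(U₁^u) = (M^i U₁)^{u↾T^{(i)}}`, then §1). [cite: Balaban1985Averaging, (76) p.29, (82) p.30] -/
theorem toMS_eq_of_axialGauge {u : GaugeTransf P 0 G} {U₁ : GaugeField P 0 G} {i : ℕ} (hi : i ≤ P.m + P.K)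
    (hax : AxialGauge (cd i) (Averaging.iter av i (gaugeAct u U₁))) {y : Site P (i+1)} {x : Site P i} (hx : blockOf x = y) (hxy : x ≠ emb y) :
    toMS u i x = toMS u i (emb y) * (cd i).holTo (Averaging.iter av i U₁) y x := by
  rw [iter_gaugeAct av u U₁ i hi] at hax
  exact gauge_eq_of_axialGauge (cd i) hax hx hxy

omit [GaugeGroup G] in
/-- `u↾T^{(i+1)}(y) = u↾T^{(i)}(emb y)` (definitional: `embIter (i+1) y = embIter i (emb y)`). [cite: Balaban1987RG1, (0.1) p.251] -/
theorem toMS_succ_apply (u : GaugeTransf P 0 G) (i : ℕ) (y : Site P (i+1)) : toMS u (i + 1) y = toMS u i (emb y) := rfl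

/-- ★★ **(84) at flat background, by induction on the level** («(R̄₀ʲu)(x_j) = u(x_j)R̄_{0,x_j}U₁^{(j)}, x_j ∈ Ω^{(j)}»): if the averages `M^i(U₁^u)` are block-axial at every
level `i < j` (`j ≤ m + K`), then `R̄ʲu = u↾T^{(j)} · S_j(U₁)` pointwise — `𝓔` local on blocks, `cd` trivial at centres. [cite: Balaban1985Averaging, (84) p.30] -/
theorem gaugeAvgIter_eq_mul_shearRIter
    (h𝓔 : ∀ (i : ℕ) (y : Site P (i+1)) (f f' : Site P i → G), (∀ x, blockOf x = y → f x = f' x) → 𝓔 i y f = 𝓔 i y f')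
    (hctr : ∀ (i : ℕ) (U : GaugeField P i G) (y : Site P (i+1)), (cd i).holTo U y (emb y) = 1)
    {u : GaugeTransf P 0 G} {U₁ : GaugeField P 0 G} :
    ∀ (j : ℕ), j ≤ P.m + P.K → (∀ i < j, AxialGauge (cd i) (Averaging.iter av i (gaugeAct u U₁))) →
      ∀ y : Site P j, gaugeAvgIter 𝓔 u j y = toMS u j y * shearRIter av cd 𝓔 U₁ j y
  | 0, _, _, y => (mul_one _).symm
  | j + 1, hj, hax, y => by
      have hj' : j ≤ P.m + P.K := Nat.le_of_succ_le hj
      have ih := gaugeAvgIter_eq_mul_shearRIter h𝓔 hctr j hj' (fun i hi => hax i (Nat.lt_succ_of_lt hi))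
      have haxj := hax j (Nat.lt_succ_self j)
      show gaugeAvgF (𝓔 j) (gaugeAvgIter 𝓔 u j) y = toMS u (j + 1) y * (shearRIter av cd 𝓔 U₁ j (emb y) *
        𝓔 j y (fun x => (shearRIter av cd 𝓔 U₁ j (emb y))⁻¹ * (cd j).holTo (Averaging.iter av j U₁) y x * shearRIter av cd 𝓔 U₁ j x))
      unfold gaugeAvgF
      rw [ih (emb y), toMS_succ_apply, mul_assoc]
      congr 1
      congr 1
      refine h𝓔 j y _ _ fun x hx => ?_
      rw [ih x]
      by_cases hxy : x = emb y
      · subst hxy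
        rw [hctr, mul_one, inv_mul_cancel, inv_mul_cancel]
      · rw [toMS_eq_of_axialGauge av cd hj' haxj hx hxy, mul_inv_rev]
        simp only [mul_assoc]
        congr 1
        rw [← mul_assoc, ← mul_assoc, inv_mul_cancel, one_mul]

/-- ★★ **(87) at every normalised site, flat** («hence u(y) = (R̄_{0,y}U₁^{(k)})⁻¹»; [B11] p.301 «ūʲ = 1 on Λ′_j»): under the axial gauges below level `j`, at every site `y` of
`T^{(j)}` where the (81)∕(1.29)-normalisation `(R̄ʲu)(y) = 1` holds, `u↾T^{(j)}(y) = S_j(U₁)(y)⁻¹` — INTRINSIC in `U₁`. [cite: Balaban1985Averaging, (87) p.31; Balaban1985Variational, (152) p.301] -/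
theorem toMS_eq_shearRIter_inv
    (h𝓔 : ∀ (i : ℕ) (y : Site P (i+1)) (f f' : Site P i → G), (∀ x, blockOf x = y → f x = f' x) → 𝓔 i y f = 𝓔 i y f')
    (hctr : ∀ (i : ℕ) (U : GaugeField P i G) (y : Site P (i+1)), (cd i).holTo U y (emb y) = 1)
    {u : GaugeTransf P 0 G} {U₁ : GaugeField P 0 G} {j : ℕ} (hj : j ≤ P.m + P.K)
    (hax : ∀ i < j, AxialGauge (cd i) (Averaging.iter av i (gaugeAct u U₁))) {y : Site P j} (h81 : gaugeAvgIter 𝓔 u j y = 1) :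
    toMS u j y = (shearRIter av cd 𝓔 U₁ j y)⁻¹ := by
  rw [gaugeAvgIter_eq_mul_shearRIter av cd 𝓔 h𝓔 hctr j hj hax y] at h81
  exact eq_inv_of_mul_eq_one_left h81

/-- ★★★ **(88) ∕ [B11] (154)₁ AT LEVEL `j`, flat — THE SHEARED `j`-FOLD AVERAGE OF `U₁` IS THE `j`-FOLD AVERAGE OF THE AXIAL-GAUGED `U′ = U₁^u`**: under the block axial gauges
of `M^i(U′)`, `i < j`, and the normalisation `(R̄ʲu) = 1` at both ends of the bond `c` of `T^{(j)}` (print: both end-points in `Λ′_j`),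
`(S_j(c₋))⁻¹ · M^j(U₁)(c) · S_j(c₊) = M^j(U′)(c)`. [cite: Balaban1985Averaging, (88) p.31; Balaban1985Variational, (154) p.302] -/
theorem shearedAvgIter_eq_iter_gauge
    (h𝓔 : ∀ (i : ℕ) (y : Site P (i+1)) (f f' : Site P i → G), (∀ x, blockOf x = y → f x = f' x) → 𝓔 i y f = 𝓔 i y f')
    (hctr : ∀ (i : ℕ) (U : GaugeField P i G) (y : Site P (i+1)), (cd i).holTo U y (emb y) = 1)
    {u : GaugeTransf P 0 G} {U₁ : GaugeField P 0 G} {j : ℕ} (hj : j ≤ P.m + P.K)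
    (hax : ∀ i < j, AxialGauge (cd i) (Averaging.iter av i (gaugeAct u U₁))) {c : PBond P j}
    (hsrc : gaugeAvgIter 𝓔 u j c.src = 1) (htgt : gaugeAvgIter 𝓔 u j c.tgt = 1) :
    shearedAvgIter av cd 𝓔 U₁ j c = Averaging.iter av j (gaugeAct u U₁) c := by
  rw [iter_gaugeAct av u U₁ j hj]
  show _ = toMS u j c.src * Averaging.iter av j U₁ c * (toMS u j c.tgt)⁻¹
  rw [toMS_eq_shearRIter_inv av cd 𝓔 h𝓔 hctr hj hax hsrc, toMS_eq_shearRIter_inv av cd 𝓔 h𝓔 hctr hj hax htgt, inv_inv]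
  rfl

/-- **(154)₁ at level `j` as print states it**: with the constraint `M^j(U′)(c) = V″(c)` at a bond of `Λ′_j` whose ends are normalised, the sheared `j`-fold average of
`U₁` equals the DATA `V″(c)` — a constraint on `U₁` ALONE with PURE data. [cite: Balaban1985Variational, (154) p.302, (156) p.302] -/
theorem shearedAvgIter_eq_data
    (h𝓔 : ∀ (i : ℕ) (y : Site P (i+1)) (f f' : Site P i → G), (∀ x, blockOf x = y → f x = f' x) → 𝓔 i y f = 𝓔 i y f')
    (hctr : ∀ (i : ℕ) (U : GaugeField P i G) (y : Site P (i+1)), (cd i).holTo U y (emb y) = 1)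
    {u : GaugeTransf P 0 G} {U₁ : GaugeField P 0 G} {j : ℕ} (hj : j ≤ P.m + P.K)
    (hax : ∀ i < j, AxialGauge (cd i) (Averaging.iter av i (gaugeAct u U₁))) {V : GaugeField P j G} {c : PBond P j}
    (hV : Averaging.iter av j (gaugeAct u U₁) c = V c) (hsrc : gaugeAvgIter 𝓔 u j c.src = 1) (htgt : gaugeAvgIter 𝓔 u j c.tgt = 1) :
    shearedAvgIter av cd 𝓔 U₁ j c = V c := by
  rw [shearedAvgIter_eq_iter_gauge av cd 𝓔 h𝓔 hctr hj hax hsrc htgt, hV]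

/-- CONSISTENCY: at level `1` the hierarchical objects are the one-step ones of §1 (`S₁ = 1·𝓔{1⁻¹·U₁(Γ)·1} = shearR`). [cite: Balaban1985Averaging, (90) p.31 (bookkeeping)] -/
theorem shearRIter_one (U₁ : GaugeField P 0 G) (y : Site P 1) : shearRIter av cd 𝓔 U₁ 1 y = shearR (cd 0) (𝓔 0) U₁ y := by
  show (1 : G) * 𝓔 0 y (fun x => (1 : G)⁻¹ * (cd 0).holTo (Averaging.iter av 0 U₁) y x * 1) = 𝓔 0 y (fun x => (cd 0).holTo U₁ y x)
  simp only [one_mul, inv_one, mul_one]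
  rfl

end Hierarchy

end Literature.MathematicalPhysics.QuantumFieldTheory.Balaban1983to89.Node00
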